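import Mathlib
import HarnessLib
import Literature.NumberTheory.LFunctions.RHWave0
import Literature.NumberTheory.LFunctions.LogFreeDensityTheorem14
import Literature.NumberTheory.LFunctions.LiouvilleSumClassicalBound
import Literature.AlgebraicGeometry.HodgeTheory.FermatHodgeCharacterExistence

/-!
# `TypeIILiouville` (crux stmt-Parity-13322, route `LiouvilleMAD`), line `Sketch`: Stub V

The non-principal remainder over the primes `p ∈ (N, 2N]`, `y^θ/2 ≤ N ≤ y^θ`. By Stub B (hypothesis
`hB`) each summand is `(1/(p − 1)) ∑_{χ ≠ χ₀ mod p} χ(−1) S_χ(y)`, `S_χ(y) = ∑_{k ≤ y} λ(k)χ(k)`. The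
characters whose `L(s, χ)` has no zero in `1 − δ₀ ≤ Re s < 1`, `|Im s| ≤ (2N)⁶` are power-small by
Stub U2 (hypothesis `hU2`, modulus `p ≤ 2N ≤ y^{ε/2}`, height `y^ε + 1 ≤ (2N)⁶`): total
`≤ 2C N y^{1−ε/2} ≤ 2C y^{1−ε/4}` (`θ = ε/4`). The others are primitive and carry a zero of multiplicity
`≥ 1` in the box: by Bombieri's log-free density theorem (`LogFreeDensity.logFreeDensity_dirichlet`,
PROVED in the tree) there are `≤ C_D (2N)^{c_D δ₀} ≤ 2 C_D y^{θ/2}` of them (`c_D δ₀ ≤ 1/2`), each of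
trivial cost `≤ y/(p − 1) ≤ y/N`: total `≤ 4 C_D y^{1−θ/2}`. Hence the bound `(2C + 4C_D) y^{1−ε/8}`
(`stub_V`, consumed verbatim by Stub C of the line).
-/

noncomputable section

open Finset ArithmeticFunction Filter Asymptotics
open Literature.NumberTheory.LFunctions

namespace Summit.Parity.GeneralizedHardyLittlewood.Theorems.TypeIILiouville

/-- Trivial bound `‖∑_{k ≤ y} λ(k)χ(k)‖ ≤ y` (`|λ| ≤ 1`, `‖χ‖ ≤ 1`). -/
theorem stubV_norm_twist_le {q : ℕ} (χ : DirichletCharacter ℂ q) (y : ℕ) :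
    ‖∑ k ∈ Icc 1 y, (liouville k : ℂ) * χ (k : ZMod q)‖ ≤ y := by
  refine (norm_sum_le _ _).trans ?_
  calc ∑ k ∈ Icc 1 y, ‖(liouville k : ℂ) * χ (k : ZMod q)‖ ≤ ∑ k ∈ Icc 1 y, (1 : ℝ) := by
        refine sum_le_sum fun k _ => ?_
        rw [norm_mul]
        have h1 : ‖(liouville k : ℂ)‖ ≤ 1 := by
          rw [Complex.norm_intCast]; exact LiouvilleSum.abs_liouville_le_one k
        calc ‖(liouville k : ℂ)‖ * ‖χ (k : ZMod q)‖ ≤ 1 * 1 :=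
              mul_le_mul h1 (χ.norm_le_one _) (norm_nonneg _) zero_le_one
          _ = 1 := one_mul 1
    _ = y := by simp

/-- Reindexing `p = q' + 1`: a nonnegative `g` summed at `p − 1` over the primes `p ∈ (N, 2N]` is at
most its sum over `q' ∈ [1, 2N)`. -/
theorem stubV_sum_primes_le {N : ℕ} (g : ℕ → ℝ) (hg : ∀ q, 0 ≤ g q) :
    ∑ p ∈ (Ioc N (2 * N)).filter Nat.Prime, g (p - 1) ≤ ∑ q ∈ Ico 1 (2 * N), g q := by
  have hinj : Set.InjOn (fun p : ℕ => p - 1) ((Ioc N (2 * N)).filter Nat.Prime : Set ℕ) := by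
    intro a ha b hb hab
    have ha2 := (mem_filter.1 (mem_coe.1 ha)).2.one_le
    have hb2 := (mem_filter.1 (mem_coe.1 hb)).2.one_le
    simp only at hab
    omega
  rw [← sum_image (f := g) hinj]
  refine sum_le_sum_of_subset_of_nonneg (fun q hq => ?_) (fun q _ _ => hg q)
  obtain ⟨p, hp, rfl⟩ := mem_image.1 hq
  rw [mem_filter, mem_Ioc] at hp
  rw [mem_Ico]
  have := hp.2.two_le
  omega

/-- From Stub B at the prime `n + 1` (hypothesis `hBp`): the remainder
`∑_{k ≤ y, n+1 ∣ k+1} λ(k) − (L(y) + L(⌊y/(n+1)⌋))/n` is bounded in absolute value by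
`(1/n) ∑_{χ ≠ χ₀} ‖S_χ(y)‖` (`‖χ(−1)‖ ≤ 1`). -/
theorem stubV_abs_remainder_le {n y : ℕ} (hn : 1 ≤ n)
    (hBp : (∑ k ∈ (Icc 1 y).filter (fun k => n + 1 ∣ k + 1), (liouville k : ℂ)) =
        ((liouvilleSum (y : ℝ) : ℂ) + (liouvilleSum ((y / (n + 1) : ℕ) : ℝ) : ℂ)) /
            (((n + 1 : ℕ) : ℂ) - 1) +
          (1 / (((n + 1 : ℕ) : ℂ) - 1)) *
            ∑ χ ∈ (univ : Finset (DirichletCharacter ℂ (n + 1))).erase 1,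
              χ (-1) * ∑ k ∈ Icc 1 y, (liouville k : ℂ) * χ (k : ZMod (n + 1))) :
    |(∑ k ∈ (Icc 1 y).filter (fun k => n + 1 ∣ k + 1), (liouville k : ℝ)) -
        ((liouvilleSum (y : ℝ) : ℝ) + (liouvilleSum ((y / (n + 1) : ℕ) : ℝ) : ℝ)) /
          (((n + 1 : ℕ) : ℝ) - 1)| ≤
      1 / (n : ℝ) * ∑ χ ∈ (univ : Finset (DirichletCharacter ℂ (n + 1))).erase 1,
        ‖∑ k ∈ Icc 1 y, (liouville k : ℂ) * χ (k : ZMod (n + 1))‖ := by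
  have hnC : ((n + 1 : ℕ) : ℂ) - 1 = (n : ℂ) := by push_cast; ring
  have hE : (((∑ k ∈ (Icc 1 y).filter (fun k => n + 1 ∣ k + 1), (liouville k : ℝ)) -
        ((liouvilleSum (y : ℝ) : ℝ) + (liouvilleSum ((y / (n + 1) : ℕ) : ℝ) : ℝ)) /
          (((n + 1 : ℕ) : ℝ) - 1) : ℝ) : ℂ) =
      (1 / (((n + 1 : ℕ) : ℂ) - 1)) *
        ∑ χ ∈ (univ : Finset (DirichletCharacter ℂ (n + 1))).erase 1,
          χ (-1) * ∑ k ∈ Icc 1 y, (liouville k : ℂ) * χ (k : ZMod (n + 1)) := by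
    simp only [Complex.ofReal_sub, Complex.ofReal_div, Complex.ofReal_add, Complex.ofReal_sum,
      Complex.ofReal_intCast, Complex.ofReal_natCast, Complex.ofReal_one]
    rw [hBp, add_sub_cancel_left]
  rw [← Real.norm_eq_abs, ← Complex.norm_real, hE, norm_mul, hnC, norm_div, norm_one,
    Complex.norm_natCast]
  refine mul_le_mul_of_nonneg_left ((norm_sum_le _ _).trans (sum_le_sum fun χ _ => ?_))
    (by positivity)
  rw [norm_mul]
  exact mul_le_of_le_one_left (norm_nonneg _) (χ.norm_le_one _)

/-- One non-principal character `χ` mod `n + 1`: either `L(s, χ)` has no zero in the box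
`1 − δ₀ ≤ Re s < 1`, `|Im s| ≤ P⁶` — then the power saving `hgood` applies, the box containing the
one of height `y^ε + 1` — or the chosen zero `ρ ∈ Z(n+1, χ)` has multiplicity `≥ 1` and pays for the
trivial bound `y`. -/
theorem stubV_char_bound {n y : ℕ} {δ₀ ε C P : ℝ} (hC : 0 ≤ C)
    (hgood : ∀ χ : DirichletCharacter ℂ (n + 1), χ ≠ 1 →
        (∀ z : ℂ, 1 - δ₀ ≤ z.re → z.re < 1 → |z.im| ≤ (y : ℝ) ^ ε + 1 → χ.LFunction z ≠ 0) →
        ‖∑ k ∈ Icc 1 y, (liouville k : ℂ) * χ (k : ZMod (n + 1))‖ ≤ C * (y : ℝ) ^ (1 - ε / 2))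
    (hheight : (y : ℝ) ^ ε + 1 ≤ P ^ 6)
    (Z : (q : ℕ) → DirichletCharacter ℂ q → Finset ℂ)
    (hZ : ∀ χ : DirichletCharacter ℂ (n + 1),
        (∃ ρ : ℂ, χ.LFunction ρ = 0 ∧ 1 - δ₀ ≤ ρ.re ∧ ρ.re < 1 ∧ |ρ.im| ≤ P ^ 6) →
          ∃ ρ ∈ Z (n + 1) χ, 1 - δ₀ ≤ ρ.re ∧ χ.LFunction ρ = 0)
    (χ : DirichletCharacter ℂ (n + 1)) (hχ : χ ≠ 1) :
    ‖∑ k ∈ Icc 1 y, (liouville k : ℂ) * χ (k : ZMod (n + 1))‖ ≤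
      C * (y : ℝ) ^ (1 - ε / 2) +
        y * ∑ ρ ∈ (Z (n + 1) χ).filter (fun ρ => 1 - δ₀ ≤ ρ.re),
          (DirichletDisc.zeroOrder χ ρ : ℝ) := by
  have hA : 0 ≤ C * (y : ℝ) ^ (1 - ε / 2) := by positivity
  by_cases hbad : ∃ ρ : ℂ, χ.LFunction ρ = 0 ∧ 1 - δ₀ ≤ ρ.re ∧ ρ.re < 1 ∧ |ρ.im| ≤ P ^ 6
  · obtain ⟨ρ, hρZ, hρre, hρ0⟩ := hZ χ hbad
    have h1 : (1 : ℝ) ≤ ∑ ρ ∈ (Z (n + 1) χ).filter (fun ρ => 1 - δ₀ ≤ ρ.re),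
        (DirichletDisc.zeroOrder χ ρ : ℝ) := by
      have hmem : ρ ∈ (Z (n + 1) χ).filter (fun ρ => 1 - δ₀ ≤ ρ.re) := mem_filter.2 ⟨hρZ, hρre⟩
      have hord : (1 : ℝ) ≤ (DirichletDisc.zeroOrder χ ρ : ℝ) := by
        exact_mod_cast (DirichletDisc.zeroOrder_pos_iff χ hχ ρ).2 hρ0
      exact hord.trans (single_le_sum (fun ρ' _ => Nat.cast_nonneg _) hmem)
    calc ‖∑ k ∈ Icc 1 y, (liouville k : ℂ) * χ (k : ZMod (n + 1))‖ ≤ y := stubV_norm_twist_le χ y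
      _ ≤ (y : ℝ) * ∑ ρ ∈ (Z (n + 1) χ).filter (fun ρ => 1 - δ₀ ≤ ρ.re),
            (DirichletDisc.zeroOrder χ ρ : ℝ) := le_mul_of_one_le_right (Nat.cast_nonneg _) h1
      _ ≤ _ := le_add_of_nonneg_left hA
  · push Not at hbad
    have hzf : ∀ z : ℂ, 1 - δ₀ ≤ z.re → z.re < 1 → |z.im| ≤ (y : ℝ) ^ ε + 1 →
        χ.LFunction z ≠ 0 :=
      fun z h1 h2 h3 h0 => absurd (h3.trans hheight) (not_le.2 (hbad z h0 h1 h2))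
    have hT : 0 ≤ (y : ℝ) * ∑ ρ ∈ (Z (n + 1) χ).filter (fun ρ => 1 - δ₀ ≤ ρ.re),
        (DirichletDisc.zeroOrder χ ρ : ℝ) :=
      mul_nonneg (Nat.cast_nonneg _) (sum_nonneg fun ρ _ => Nat.cast_nonneg _)
    exact (hgood χ hχ hzf).trans (le_add_of_nonneg_right hT)

open scoped Classical in
/-- Summing `stubV_char_bound` over the non-principal characters mod the prime `n + 1`: at most
`n + 1` characters, all of them primitive (tree: `FermatCharacter.isPrimitive_of_ne_one_prime`), and
the zero counts are nonnegative. -/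
theorem stubV_prime_bound {n y : ℕ} {δ₀ ε C P : ℝ} (hC : 0 ≤ C) (hp : (n + 1).Prime)
    (hgood : ∀ χ : DirichletCharacter ℂ (n + 1), χ ≠ 1 →
        (∀ z : ℂ, 1 - δ₀ ≤ z.re → z.re < 1 → |z.im| ≤ (y : ℝ) ^ ε + 1 → χ.LFunction z ≠ 0) →
        ‖∑ k ∈ Icc 1 y, (liouville k : ℂ) * χ (k : ZMod (n + 1))‖ ≤ C * (y : ℝ) ^ (1 - ε / 2))
    (hheight : (y : ℝ) ^ ε + 1 ≤ P ^ 6)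
    (Z : (q : ℕ) → DirichletCharacter ℂ q → Finset ℂ)
    (hZ : ∀ χ : DirichletCharacter ℂ (n + 1),
        (∃ ρ : ℂ, χ.LFunction ρ = 0 ∧ 1 - δ₀ ≤ ρ.re ∧ ρ.re < 1 ∧ |ρ.im| ≤ P ^ 6) →
          ∃ ρ ∈ Z (n + 1) χ, 1 - δ₀ ≤ ρ.re ∧ χ.LFunction ρ = 0) :
    ∑ χ ∈ (univ : Finset (DirichletCharacter ℂ (n + 1))).erase 1,
        ‖∑ k ∈ Icc 1 y, (liouville k : ℂ) * χ (k : ZMod (n + 1))‖ ≤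
      ((n + 1 : ℕ) : ℝ) * (C * (y : ℝ) ^ (1 - ε / 2)) +
        y * ∑ χ : DirichletCharacter ℂ (n + 1) with χ.IsPrimitive,
          ∑ ρ ∈ Z (n + 1) χ with 1 - δ₀ ≤ ρ.re, (DirichletDisc.zeroOrder χ ρ : ℝ) := by
  calc ∑ χ ∈ (univ : Finset (DirichletCharacter ℂ (n + 1))).erase 1,
        ‖∑ k ∈ Icc 1 y, (liouville k : ℂ) * χ (k : ZMod (n + 1))‖
      ≤ ∑ χ ∈ (univ : Finset (DirichletCharacter ℂ (n + 1))).erase 1,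
          (C * (y : ℝ) ^ (1 - ε / 2) +
            y * ∑ ρ ∈ Z (n + 1) χ with 1 - δ₀ ≤ ρ.re, (DirichletDisc.zeroOrder χ ρ : ℝ)) :=
        sum_le_sum fun χ hχ => stubV_char_bound hC hgood hheight Z hZ χ (ne_of_mem_erase hχ)
    _ = ((((univ : Finset (DirichletCharacter ℂ (n + 1))).erase 1).card : ℕ) : ℝ) *
            (C * (y : ℝ) ^ (1 - ε / 2)) +
          y * ∑ χ ∈ (univ : Finset (DirichletCharacter ℂ (n + 1))).erase 1,
            ∑ ρ ∈ Z (n + 1) χ with 1 - δ₀ ≤ ρ.re, (DirichletDisc.zeroOrder χ ρ : ℝ) := by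
        rw [sum_add_distrib, sum_const, nsmul_eq_mul, mul_sum]
    _ ≤ _ := by
        apply add_le_add
        · refine mul_le_mul_of_nonneg_right ?_ (by positivity)
          have h1 := card_erase_le (s := (univ : Finset (DirichletCharacter ℂ (n + 1)))) (a := 1)
          have h2 : (univ : Finset (DirichletCharacter ℂ (n + 1))).card ≤ n + 1 := by
            rw [card_univ]; exact LogFreeDensity.card_dirichletCharacter_le (n + 1)
          exact_mod_cast h1.trans h2
        · refine mul_le_mul_of_nonneg_left ?_ (Nat.cast_nonneg _)
          refine sum_le_sum_of_subset_of_nonneg (fun χ hχ => ?_)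
            (fun χ _ _ => sum_nonneg fun ρ _ => Nat.cast_nonneg _)
          exact mem_filter.2 ⟨mem_univ _,
            Literature.AlgebraicGeometry.HodgeTheory.FermatCharacter.isPrimitive_of_ne_one_prime hp
              (ne_of_mem_erase hχ)⟩

/-- **Stub V.** From Stub B (as `hB`), Stub U2 (as `hU2`) and Bombieri's log-free density theorem
(tree, `LogFreeDensity.logFreeDensity_dirichlet`): for some `0 < θ ≤ 1/4`, `δ₂ > 0`,
`|∑_{N<p≤2N} (∑_{k≤y, p∣k+1} λ(k) − (L(y)+L(⌊y/p⌋))/(p−1))| ≤ C₂ y^{1−δ₂}` whenever `y^θ/2 ≤ N ≤ y^θ`,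
`y ≥ y₀` (here `θ = ε/4`, `δ₂ = ε/8`, `ε` the exponent of Stub U2 at `δ₀ = min(1/4, 1/(2c_D))`). -/
theorem stub_V
    (hB : ∀ (p : ℕ) [Fact p.Prime] (y : ℕ),
      (∑ k ∈ (Icc 1 y).filter (fun k => p ∣ k + 1), (liouville k : ℂ)) =
        ((liouvilleSum (y : ℝ) : ℂ) + (liouvilleSum ((y / p : ℕ) : ℝ) : ℂ)) / ((p : ℂ) - 1) +
          (1 / ((p : ℂ) - 1)) * ∑ χ ∈ (univ : Finset (DirichletCharacter ℂ p)).erase 1,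
            χ (-1) * ∑ k ∈ Icc 1 y, (liouville k : ℂ) * χ (k : ZMod p))
    (hU2 : ∀ δ₀ : ℝ, 0 < δ₀ → δ₀ ≤ 1 / 4 → ∃ ε : ℝ, 0 < ε ∧ ε ≤ δ₀ ∧ ∃ C : ℝ, ∃ N₀ : ℕ,
      ∀ N : ℕ, N₀ ≤ N → ∀ (q : ℕ) [NeZero q], (q : ℝ) ≤ (N : ℝ) ^ (ε / 2) →
        ∀ χ : DirichletCharacter ℂ q, χ ≠ 1 →
          (∀ z : ℂ, 1 - δ₀ ≤ z.re → z.re < 1 → |z.im| ≤ (N : ℝ) ^ ε + 1 → χ.LFunction z ≠ 0) →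
          ‖∑ k ∈ Icc 1 N, (liouville k : ℂ) * χ (k : ZMod q)‖ ≤ C * (N : ℝ) ^ (1 - ε / 2)) :
    ∃ θ : ℝ, 0 < θ ∧ θ ≤ 1 / 4 ∧ ∃ δ₂ : ℝ, 0 < δ₂ ∧ ∃ C₂ : ℝ, ∃ y₀ : ℕ, ∀ y : ℕ, y₀ ≤ y →
      ∀ N : ℕ, (y : ℝ) ^ θ / 2 ≤ N → (N : ℝ) ≤ (y : ℝ) ^ θ →
        |∑ p ∈ (Ioc N (2 * N)).filter Nat.Prime,
            ((∑ k ∈ (Icc 1 y).filter (fun k => p ∣ k + 1), (liouville k : ℝ)) -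
              ((liouvilleSum (y : ℝ) : ℝ) + (liouvilleSum ((y / p : ℕ) : ℝ) : ℝ)) / ((p : ℝ) - 1))| ≤
          C₂ * (y : ℝ) ^ (1 - δ₂) := by
  classical
  obtain ⟨c_D, C_D, hcD, hCD, hdens⟩ := LogFreeDensity.logFreeDensity_dirichlet
  -- the width `δ₀` of the box: `c_D δ₀ ≤ 1/2`
  obtain ⟨δ₀, hδ₀⟩ : ∃ δ₀ : ℝ, δ₀ = min (1 / 4) (1 / (2 * c_D)) := ⟨_, rfl⟩
  have hδ₀_pos : 0 < δ₀ := by rw [hδ₀]; positivity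
  have hδ₀_le : δ₀ ≤ 1 / 4 := by rw [hδ₀]; exact min_le_left _ _
  have hcδ : c_D * δ₀ ≤ 1 / 2 := by
    have h1 : δ₀ ≤ 1 / (2 * c_D) := by rw [hδ₀]; exact min_le_right _ _
    calc c_D * δ₀ ≤ c_D * (1 / (2 * c_D)) := mul_le_mul_of_nonneg_left h1 hcD.le
      _ = 1 / 2 := by field_simp
  obtain ⟨ε, hε0, hεδ, C, N₀, hgood⟩ := hU2 δ₀ hδ₀_pos hδ₀_le
  -- `y₀`: `y ≥ N₀`, `y ≥ 1`, `y^{ε/4} ≥ 2`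
  have hev : ∀ᶠ y : ℕ in atTop, (2 : ℝ) ≤ (y : ℝ) ^ (ε / 4) :=
    ((tendsto_rpow_atTop (by positivity : (0 : ℝ) < ε / 4)).comp
      tendsto_natCast_atTop_atTop).eventually_ge_atTop 2
  obtain ⟨y₁, hy₁⟩ := eventually_atTop.1 hev
  refine ⟨ε / 4, by positivity, by linarith, ε / 8, by positivity, 2 * max C 0 + 4 * C_D,
    max (max N₀ 1) y₁, fun y hy N hN1 hN2 => ?_⟩
  have hyN₀ : N₀ ≤ y := le_trans (le_max_left _ _) (le_of_max_le_left hy)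
  have hy1 : 1 ≤ y := le_trans (le_max_right _ _) (le_of_max_le_left hy)
  have hy2 : (2 : ℝ) ≤ (y : ℝ) ^ (ε / 4) := hy₁ y (le_of_max_le_right hy)
  have hY1 : (1 : ℝ) ≤ y := by exact_mod_cast hy1
  have hY0 : (0 : ℝ) < y := by linarith
  have ePow (a b : ℝ) : (y : ℝ) ^ a * (y : ℝ) ^ b = (y : ℝ) ^ (a + b) :=
    (Real.rpow_add hY0 a b).symm
  have hC' : 0 ≤ max C 0 := le_max_right _ _
  -- `N ≥ 1` and `P = 2N`
  have hNr1 : (1 : ℝ) ≤ N := by linarith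
  have hN0 : (0 : ℝ) < N := by linarith
  obtain ⟨P, hP⟩ : ∃ P : ℝ, P = 2 * (N : ℝ) := ⟨_, rfl⟩
  have hP2 : 2 ≤ P := by rw [hP]; linarith
  have hP0 : 0 ≤ P := by linarith
  have hP1 : 1 ≤ P := by linarith
  have hPθ : (y : ℝ) ^ (ε / 4) ≤ P := by rw [hP]; linarith
  have hPle : P ≤ 2 * (y : ℝ) ^ (ε / 4) := by rw [hP]; linarith
  have hfloor : ⌊P⌋₊ = 2 * N := by
    rw [hP, show (2 * (N : ℝ)) = ((2 * N : ℕ) : ℝ) by push_cast; ring, Nat.floor_natCast]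
  -- `2 y^{ε/4} ≤ y^{ε/2}` and the height `y^ε + 1 ≤ P⁶`
  have hε2 : 2 * (y : ℝ) ^ (ε / 4) ≤ (y : ℝ) ^ (ε / 2) := by
    calc 2 * (y : ℝ) ^ (ε / 4) ≤ (y : ℝ) ^ (ε / 4) * (y : ℝ) ^ (ε / 4) :=
          mul_le_mul_of_nonneg_right hy2 (by positivity)
      _ = (y : ℝ) ^ (ε / 2) := by rw [ePow]; congr 1; ring
  have hheight : (y : ℝ) ^ ε + 1 ≤ P ^ 6 := by
    have h1 : ((y : ℝ) ^ (ε / 4)) ^ 6 ≤ P ^ 6 := pow_le_pow_left₀ (by positivity) hPθ 6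
    have h2 : ((y : ℝ) ^ (ε / 4)) ^ 6 = (y : ℝ) ^ ε * (y : ℝ) ^ (ε / 2) := by
      rw [← Real.rpow_natCast, ← Real.rpow_mul hY0.le, ePow]; congr 1; push_cast; ring
    have h3 : (2 : ℝ) ≤ (y : ℝ) ^ (ε / 2) := by linarith [Real.one_le_rpow hY1 hε0.le]
    calc (y : ℝ) ^ ε + 1 ≤ (y : ℝ) ^ ε * 2 := by linarith [Real.one_le_rpow hY1 hε0.le]
      _ ≤ (y : ℝ) ^ ε * (y : ℝ) ^ (ε / 2) := mul_le_mul_of_nonneg_left h3 (by positivity)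
      _ = ((y : ℝ) ^ (ε / 4)) ^ 6 := h2.symm
      _ ≤ P ^ 6 := h1
  -- the zero sets `Z(q, χ)`: one chosen zero of `L(s, χ)` in the box, if there is any
  obtain ⟨Z, hZdef⟩ : ∃ Z : (q : ℕ) → DirichletCharacter ℂ q → Finset ℂ,
      ∀ (n : ℕ) (χ : DirichletCharacter ℂ (n + 1)), Z (n + 1) χ =
        if h : ∃ ρ : ℂ, χ.LFunction ρ = 0 ∧ 1 - δ₀ ≤ ρ.re ∧ ρ.re < 1 ∧ |ρ.im| ≤ P ^ 6
        then {h.choose} else ∅ :=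
    ⟨fun q => match q with
      | 0 => fun _ => ∅
      | n + 1 => fun χ =>
        if h : ∃ ρ : ℂ, χ.LFunction ρ = 0 ∧ 1 - δ₀ ≤ ρ.re ∧ ρ.re < 1 ∧ |ρ.im| ≤ P ^ 6
        then {h.choose} else ∅,
     fun n χ => rfl⟩
  have hZ1 : ∀ (q' : ℕ) (χ : DirichletCharacter ℂ (q' + 1)), ∀ ρ ∈ Z (q' + 1) χ,
      χ.LFunction ρ = 0 ∧ 0 < ρ.re ∧ ρ.re < 1 ∧ |ρ.im| ≤ P ^ 6 := by
    intro q' χ ρ hρ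
    rw [hZdef] at hρ
    by_cases h : ∃ ρ : ℂ, χ.LFunction ρ = 0 ∧ 1 - δ₀ ≤ ρ.re ∧ ρ.re < 1 ∧ |ρ.im| ≤ P ^ 6
    · rw [dif_pos h, mem_singleton] at hρ
      obtain ⟨h0, h1, h2, h3⟩ := h.choose_spec
      exact hρ ▸ ⟨h0, by linarith, h2, h3⟩
    · rw [dif_neg h] at hρ
      exact absurd hρ (notMem_empty ρ)
  have hZ2 : ∀ (n : ℕ) (χ : DirichletCharacter ℂ (n + 1)),
      (∃ ρ : ℂ, χ.LFunction ρ = 0 ∧ 1 - δ₀ ≤ ρ.re ∧ ρ.re < 1 ∧ |ρ.im| ≤ P ^ 6) →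
        ∃ ρ ∈ Z (n + 1) χ, 1 - δ₀ ≤ ρ.re ∧ χ.LFunction ρ = 0 := by
    intro n χ h
    refine ⟨h.choose, ?_, h.choose_spec.2.1, h.choose_spec.1⟩
    rw [hZdef, dif_pos h]
    exact mem_singleton_self _
  -- Bombieri's log-free density theorem at `α = 1 − δ₀`
  have hd := hdens P hP2 Z hZ1 (1 - δ₀) (by linarith) (by linarith)
  rw [hfloor, sub_sub_cancel] at hd
  -- `g(q')`: the chosen zeros of the primitive characters mod `q' + 1`, with multiplicity
  obtain ⟨g, hg⟩ : ∃ g : ℕ → ℝ, g = fun q' =>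
      ∑ χ : DirichletCharacter ℂ (q' + 1) with χ.IsPrimitive,
        ∑ ρ ∈ Z (q' + 1) χ with 1 - δ₀ ≤ ρ.re, (DirichletDisc.zeroOrder χ ρ : ℝ) := ⟨_, rfl⟩
  have hg0 : ∀ q', 0 ≤ g q' := fun q' => by
    rw [hg]; exact sum_nonneg fun χ _ => sum_nonneg fun ρ _ => Nat.cast_nonneg _
  have hd' : ∑ q' ∈ Ico 1 (2 * N), g q' ≤ C_D * P ^ (c_D * δ₀) := by rw [hg]; exact hd
  -- Stub U2 at length `y`
  have hgood' : ∀ n : ℕ, ((n + 1 : ℕ) : ℝ) ≤ (y : ℝ) ^ (ε / 2) →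
      ∀ χ : DirichletCharacter ℂ (n + 1), χ ≠ 1 →
        (∀ z : ℂ, 1 - δ₀ ≤ z.re → z.re < 1 → |z.im| ≤ (y : ℝ) ^ ε + 1 → χ.LFunction z ≠ 0) →
        ‖∑ k ∈ Icc 1 y, (liouville k : ℂ) * χ (k : ZMod (n + 1))‖ ≤
          max C 0 * (y : ℝ) ^ (1 - ε / 2) :=
    fun n hn χ hχ hzf => (hgood y hyN₀ (n + 1) hn χ hχ hzf).trans
      (mul_le_mul_of_nonneg_right (le_max_left _ _) (by positivity))
  -- the bound prime by prime
  have hprime : ∀ p ∈ (Ioc N (2 * N)).filter Nat.Prime,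
      |(∑ k ∈ (Icc 1 y).filter (fun k => p ∣ k + 1), (liouville k : ℝ)) -
          ((liouvilleSum (y : ℝ) : ℝ) + (liouvilleSum ((y / p : ℕ) : ℝ) : ℝ)) / ((p : ℝ) - 1)| ≤
        2 * (max C 0 * (y : ℝ) ^ (1 - ε / 2)) + (y : ℝ) / N * g (p - 1) := by
    intro p hpmem
    rw [mem_filter, mem_Ioc] at hpmem
    obtain ⟨⟨hNp, hp2N⟩, hp⟩ := hpmem
    obtain ⟨n, rfl⟩ : ∃ n, p = n + 1 := ⟨p - 1, (Nat.sub_add_cancel hp.one_le).symm⟩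
    rw [Nat.add_sub_cancel]
    have hn1 : 1 ≤ n := by omega
    have hnR : (1 : ℝ) ≤ n := by exact_mod_cast hn1
    have hNnR : (N : ℝ) ≤ n := by exact_mod_cast (show N ≤ n by omega)
    have hpY : ((n + 1 : ℕ) : ℝ) ≤ (y : ℝ) ^ (ε / 2) := by
      have h : ((n + 1 : ℕ) : ℝ) ≤ 2 * (N : ℝ) := by exact_mod_cast hp2N
      linarith
    have h1 := stubV_abs_remainder_le (y := y) hn1 (@hB (n + 1) ⟨hp⟩ y)
    have h2 := stubV_prime_bound hC' hp (hgood' n hpY) hheight Z (hZ2 n)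
    have h2' : ∑ χ ∈ (univ : Finset (DirichletCharacter ℂ (n + 1))).erase 1,
        ‖∑ k ∈ Icc 1 y, (liouville k : ℂ) * χ (k : ZMod (n + 1))‖ ≤
          ((n + 1 : ℕ) : ℝ) * (max C 0 * (y : ℝ) ^ (1 - ε / 2)) + y * g n := by
      rw [hg]; exact h2
    refine h1.trans ?_
    calc 1 / (n : ℝ) * ∑ χ ∈ (univ : Finset (DirichletCharacter ℂ (n + 1))).erase 1,
          ‖∑ k ∈ Icc 1 y, (liouville k : ℂ) * χ (k : ZMod (n + 1))‖
        ≤ 1 / (n : ℝ) * (((n + 1 : ℕ) : ℝ) * (max C 0 * (y : ℝ) ^ (1 - ε / 2)) + y * g n) :=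
          mul_le_mul_of_nonneg_left h2' (by positivity)
      _ = ((n + 1 : ℕ) : ℝ) / n * (max C 0 * (y : ℝ) ^ (1 - ε / 2)) + (y : ℝ) / n * g n := by
          ring
      _ ≤ 2 * (max C 0 * (y : ℝ) ^ (1 - ε / 2)) + (y : ℝ) / N * g n := by
          apply add_le_add
          · refine mul_le_mul_of_nonneg_right ?_ (by positivity)
            rw [div_le_iff₀ (by positivity)]
            push_cast
            linarith
          · exact mul_le_mul_of_nonneg_right (div_le_div_of_nonneg_left hY0.le hN0 hNnR) (hg0 n)
  -- summing over the primes `p ∈ (N, 2N]`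
  have hcard : (((Ioc N (2 * N)).filter Nat.Prime).card : ℝ) ≤ N := by
    have h := card_filter_le (Ioc N (2 * N)) Nat.Prime
    rw [Nat.card_Ioc, show 2 * N - N = N by omega] at h
    exact_mod_cast h
  have hsumg : ∑ p ∈ (Ioc N (2 * N)).filter Nat.Prime, g (p - 1) ≤ C_D * P ^ (c_D * δ₀) :=
    (stubV_sum_primes_le g hg0).trans hd'
  -- the two terms are `≪ y^{1 − ε/8}`
  have hT1 : (N : ℝ) * (2 * (max C 0 * (y : ℝ) ^ (1 - ε / 2))) ≤
      2 * max C 0 * (y : ℝ) ^ (1 - ε / 8) := by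
    have h1 : (N : ℝ) * (y : ℝ) ^ (1 - ε / 2) ≤ (y : ℝ) ^ (1 - ε / 8) := by
      calc (N : ℝ) * (y : ℝ) ^ (1 - ε / 2) ≤ (y : ℝ) ^ (ε / 4) * (y : ℝ) ^ (1 - ε / 2) :=
            mul_le_mul_of_nonneg_right hN2 (by positivity)
        _ = (y : ℝ) ^ (1 - ε / 4) := by rw [ePow]; congr 1; ring
        _ ≤ (y : ℝ) ^ (1 - ε / 8) := Real.rpow_le_rpow_of_exponent_le hY1 (by linarith)
    have h2 : (N : ℝ) * (2 * (max C 0 * (y : ℝ) ^ (1 - ε / 2))) =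
        2 * max C 0 * ((N : ℝ) * (y : ℝ) ^ (1 - ε / 2)) := by ring
    rw [h2]
    exact mul_le_mul_of_nonneg_left h1 (by positivity)
  have hPpow : P ^ (c_D * δ₀) ≤ 2 * (y : ℝ) ^ (ε / 8) := by
    calc P ^ (c_D * δ₀) ≤ P ^ (1 / 2 : ℝ) := Real.rpow_le_rpow_of_exponent_le hP1 hcδ
      _ ≤ (2 * (y : ℝ) ^ (ε / 4)) ^ (1 / 2 : ℝ) := Real.rpow_le_rpow hP0 hPle (by norm_num)
      _ = (2 : ℝ) ^ (1 / 2 : ℝ) * (y : ℝ) ^ (ε / 8) := by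
          rw [Real.mul_rpow (by norm_num) (by positivity), ← Real.rpow_mul hY0.le]
          congr 2; ring
      _ ≤ 2 * (y : ℝ) ^ (ε / 8) := by
          refine mul_le_mul_of_nonneg_right ?_ (by positivity)
          calc (2 : ℝ) ^ (1 / 2 : ℝ) ≤ (2 : ℝ) ^ (1 : ℝ) :=
                Real.rpow_le_rpow_of_exponent_le (by norm_num) (by norm_num)
            _ = 2 := Real.rpow_one 2
  have hYN : (y : ℝ) / N ≤ 2 * (y : ℝ) ^ (1 - ε / 4) := by
    rw [div_le_iff₀ hN0]
    have h1 : (y : ℝ) ^ (1 - ε / 4) * (y : ℝ) ^ (ε / 4) = y := by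
      rw [ePow, show (1 - ε / 4) + ε / 4 = (1 : ℝ) by ring, Real.rpow_one]
    have h2 : (y : ℝ) ^ (1 - ε / 4) * (y : ℝ) ^ (ε / 4) ≤ (y : ℝ) ^ (1 - ε / 4) * (2 * N) :=
      mul_le_mul_of_nonneg_left (by linarith) (by positivity)
    linarith
  have hT2 : (y : ℝ) / N * (C_D * P ^ (c_D * δ₀)) ≤ 4 * C_D * (y : ℝ) ^ (1 - ε / 8) := by
    calc (y : ℝ) / N * (C_D * P ^ (c_D * δ₀))
        ≤ (2 * (y : ℝ) ^ (1 - ε / 4)) * (C_D * (2 * (y : ℝ) ^ (ε / 8))) :=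
          mul_le_mul hYN (mul_le_mul_of_nonneg_left hPpow hCD.le) (by positivity) (by positivity)
      _ = 4 * C_D * ((y : ℝ) ^ (1 - ε / 4) * (y : ℝ) ^ (ε / 8)) := by ring
      _ = 4 * C_D * (y : ℝ) ^ (1 - ε / 8) := by rw [ePow]; congr 2; ring
  -- assembly
  refine (abs_sum_le_sum_abs _ _).trans ((sum_le_sum hprime).trans ?_)
  rw [sum_add_distrib, sum_const, nsmul_eq_mul, ← mul_sum]
  calc (((Ioc N (2 * N)).filter Nat.Prime).card : ℝ) * (2 * (max C 0 * (y : ℝ) ^ (1 - ε / 2))) +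
          (y : ℝ) / N * ∑ p ∈ (Ioc N (2 * N)).filter Nat.Prime, g (p - 1)
      ≤ (N : ℝ) * (2 * (max C 0 * (y : ℝ) ^ (1 - ε / 2))) +
          (y : ℝ) / N * (C_D * P ^ (c_D * δ₀)) :=
        add_le_add (mul_le_mul_of_nonneg_right hcard (by positivity))
          (mul_le_mul_of_nonneg_left hsumg (by positivity))
    _ ≤ 2 * max C 0 * (y : ℝ) ^ (1 - ε / 8) + 4 * C_D * (y : ℝ) ^ (1 - ε / 8) := add_le_add hT1 hT2
    _ = (2 * max C 0 + 4 * C_D) * (y : ℝ) ^ (1 - ε / 8) := by ring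

end Summit.Parity.GeneralizedHardyLittlewood.Theorems.TypeIILiouville

end
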